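import Summits.AnomalousDissipation.AnomalousDissipation.Theorems.SolenoidalFractalHomogenisationLagrangianStepSidebandLadderCrushChoice
import HarnessLib

/-!
# K1L_D `stub_D1_V0thg` (stmt-AnomalousDissipation-27980), R3′ lane «SidebandTailCrushing» — file F4h∘F5 (iii): the LADDER CRUSH on the
# HALF-HEIGHT WINDOW of a slot (`G₋ = 1/2`, `G₊ = 1`, other envelopes off — the slot bookkeeping of the R3′ plan memo §4)

Helper file of route `SolenoidalFractalHomogenisation` (`--supports stmt-AnomalousDissipation-27980 --as helper`; one-generation hand
`leafhand-ad-solenoidalfractalh-1` g0, road E-c).  The R3′ plan memo (`Cruxes/LagrangianRenormalisationStepDesign/Lines/onelevel-vtheta-R3-plan.md`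
§4, «TIME-DEPENDENCE») applies the crushing lemma on the half-height window `[startᵢ + τᵢ/4, startᵢ + 3τᵢ/4]` of slot `i`, where the own
trapezoidal envelope is in `[1/2, 1]` (ramp fraction `ρ ≤ 1/2`) and every other envelope vanishes.  `ladder_crush_halfslot` is
`Sideband.ladder_crush_choice` on exactly that window with `Gm = 1/2`, `GM = 1`: for a solution of the truncated sideband system on the
half-height window that starts (at `startᵢ + τᵢ/4`) in the ladder subspace of the hopping ladder `z₀ + ℤmᵢ`, under `NearIso 𝔸 lo' hi'`,
`OddSmall 𝔸 βo`, with `b = (lo₁/(4S²))^{1/3}`, `q = 1/√(2S)`, `lam = min(lo₁/(6Sb²), lo₁/(6U₂), 1/(6U₃), b/(3U₁)) > 0` and the two environmental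
conditions (odd-viscosity feasibility `128(ρ(1+Mo))² ≤ S`, box radius `16bη₀ ≤ 1`, `η₀ = 6a²/((R−M)4π²lo')`), for every `0 < δ₁ ≤ τᵢ/2`:
`‖u(startᵢ + 3τᵢ/4)‖² ≤ 3(1 + Sb²/(2δ₁lo₁))·exp(−lam(τᵢ/2 − δ₁))·‖u(startᵢ + τᵢ/4)‖²`.
What is left for `ladder_crush_nu` (not here): `lo' = 10ν/11`, `hi' = 11ν/10`, `βo = ντ·11/10` (⇒ `lo₁ ∝ ν`, `b ∝ ν^{1/3}`), `ε ∝ ν^{1/3}`,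
`R − M ≳ ν^{−2/3}`, `δ₁ = ν^{−1/3}` and `τᵢ = τᵢ⁰·MB/ν` ⇒ crushing factor `exp(−c′τᵢ⁰MBν^{−1/3})`; then the R3′-2 spine.  No definitions, no sorry.
NOT a proof of `stub_D1_V0thg`, of K1L_D or of AD; rung F-D1.A0 infrastructure.
-/

set_option linter.dupNamespace false -- single-conjunct summit: `Summit.AnomalousDissipation.AnomalousDissipation.…` is the mandated namespace

noncomputable section

namespace Summit.AnomalousDissipation.AnomalousDissipation.Theorems.SolenoidalFractalHomogenisation.LagrangianStep.Sideband

open Set Complex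
open scoped InnerProductSpace
open Literature.Analysis Literature.Analysis.FunctionSpaces Literature.Analysis.FunctionSpaces.Torus
open Literature.Analysis.FluidPDE Literature.Analysis.FluidPDE.Torus Literature.Analysis.FluidPDE.LatticeShear

variable {k₀ : ℕ}

/-- On the half-height window `[a + τ/4, a + 3τ/4]` of a slot with ramp fraction `0 < ρ ≤ 1/2` the trapezoidal envelope is at least `1/2`.
[cite: ArmstrongVicol2025, §4 p. 17 (time cutoff)] -/
theorem half_le_trapezoid_of_mem_halfWindow {a τ ρ s : ℝ} (hτ : 0 < τ) (hρ : 0 < ρ) (hρ2 : ρ ≤ 1 / 2)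
    (hs : s ∈ Icc (a + τ / 4) (a + 3 * τ / 4)) : 1 / 2 ≤ LatticeWord.trapezoid a τ ρ s := by
  rw [LatticeWord.trapezoid]
  have hρτ : 0 < ρ * τ := mul_pos hρ hτ
  have h4 : (1:ℝ) / 2 ≤ 1 / (4 * ρ) := by
    rw [div_le_div_iff₀ (by norm_num) (by positivity)]
    linarith
  have hx : 1 / 2 ≤ (s - a) / (ρ * τ) := by
    refine h4.trans ?_
    rw [div_le_div_iff₀ (by positivity) hρτ]
    nlinarith [hs.1]
  have hy : 1 / 2 ≤ (a + τ - s) / (ρ * τ) := by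
    refine h4.trans ?_
    rw [div_le_div_iff₀ (by positivity) hρτ]
    nlinarith [hs.2]
  exact le_max_of_le_right (le_min (by norm_num) (le_min hx hy))

/-- The half-height window of slot `i` lies inside the (half-open) slot. [folklore] -/
theorem halfWindow_subset_slot (W₁ : LatticeWord k₀) (i : Fin k₀) :
    Icc (W₁.start i + (W₁.phase i).τ / 4) (W₁.start i + 3 * (W₁.phase i).τ / 4) ⊆ Ico (W₁.start i) (W₁.start i + (W₁.phase i).τ) := by
  intro t ht
  have hτ := (W₁.phase i).τ_pos
  exact ⟨by linarith [ht.1], by linarith [ht.2]⟩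

/-- On the half-height window of slot `i`: the own envelope is in `[1/2, 1]`. [cite: ArmstrongVicol2025, §4 p. 17 (time cutoff)] -/
theorem slotEnvelope_halfWindow (W₁ : LatticeWord k₀) (i : Fin k₀) {t : ℝ}
    (ht : t ∈ Icc (W₁.start i + (W₁.phase i).τ / 4) (W₁.start i + 3 * (W₁.phase i).τ / 4)) :
    1 / 2 ≤ slotEnvelope W₁ i t ∧ slotEnvelope W₁ i t ≤ 1 := by
  refine ⟨?_, (slotEnvelope_mem_Icc W₁ i t).2⟩
  rw [slotEnvelope_eq_trapezoid_of_mem_slot W₁ i (halfWindow_subset_slot W₁ i ht)]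
  exact half_le_trapezoid_of_mem_halfWindow (W₁.phase i).τ_pos W₁.ramp_pos W₁.ramp_le ht

/-- On the half-height window of slot `i`: every other envelope vanishes. [folklore] -/
theorem slotEnvelope_other_halfWindow (W₁ : LatticeWord k₀) (i : Fin k₀) {t : ℝ}
    (ht : t ∈ Icc (W₁.start i + (W₁.phase i).τ / 4) (W₁.start i + 3 * (W₁.phase i).τ / 4)) (j : Fin k₀) (hj : j ≠ i) :
    slotEnvelope W₁ j t = 0 :=
  slotEnvelope_eq_zero_of_mem_slot W₁ hj (halfWindow_subset_slot W₁ i ht)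

set_option maxHeartbeats 400000 in -- pre-budgeted (ops-buildfix rule): large statement
/-- **LADDER CRUSH ON THE HALF-HEIGHT WINDOW OF A SLOT** (`Sideband.ladder_crush_choice` at `[startᵢ + τᵢ/4, startᵢ + 3τᵢ/4]`, `Gm = 1/2`,
`GM = 1`): hypocoercive decay across the half-height window of slot `i` of a solution of the truncated sideband system starting in the
ladder subspace of a hopping ladder, with `b = (lo₁/(4S²))^{1/3}`, `q = 1/√(2S)`, the explicit rate `lam` and the two environmental
conditions (dictionary of the bound abbreviations as in `ladder_crush_param`, with `GM = 1`).
[cite: BedrossianCotiZelati2017, §2 (hypocoercivity, enhanced dissipation)] [cite: Avron1998OddViscosity, §2 eq. (1)-(2)] -/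
theorem ladder_crush_halfslot (W₁ : LatticeWord k₀) {R : ℕ} (i : Fin k₀) (z₀ : Fin 3 → ℤ)
    (hhop : ∑ a, (W₁.phase i).e a * (z₀ a : ℝ) ≠ 0) {M : ℝ} (hM : ∀ j, |((W₁.phase i).m j : ℝ)| ≤ M) (hMR : M < R)
    {𝔸 : Torus.Visc4 (Fin 3)} {lo' hi' : ℝ} (h𝔸 : Torus.NearIso 𝔸 lo' hi') (hlo' : 0 < lo') (hhi : 0 < hi') {βo : ℝ} (hoddA : Torus.OddSmall 𝔸 βo)
    (hβo : 0 ≤ βo) {γ₁ : ℝ} (hγ₁ : 0 ≤ γ₁)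
    {u : ℝ → Space R} {δ₁ : ℝ} (hδ : 0 < δ₁) (hδτ : δ₁ ≤ (W₁.phase i).τ / 2)
    (hu : ∀ t ∈ Icc (W₁.start i + (W₁.phase i).τ / 4) (W₁.start i + 3 * (W₁.phase i).τ / 4),
      HasDerivAt u (((gen W₁ 𝔸 γ₁ R t).restrictScalars ℝ) (u t)) t)
    (h0 : u (W₁.start i + (W₁.phase i).τ / 4) ∈ ladderSub R (ladder z₀ (W₁.phase i).m))
    -- the bound abbreviations (instantiate with `rfl`)
    {a m₂ lo₁ S ρ Mo η₀ U₁ U₂ U₃ b q lam : ℝ} (ha0 : 0 < a)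
    (ha : a = 2 * Real.pi * |∑ a, (W₁.phase i).e a * (z₀ a : ℝ)| * ‖slotAmp W₁ i‖)
    (hm₂ : m₂ = freqNormSq (W₁.phase i).m) (hlo₁ : lo₁ = 4 * Real.pi ^ 2 * lo' / 7)
    (hS : S = 4 * (4 * a ^ 2) + 16 * (8 * a ^ 2 * (1 + m₂) * |hi'| / lo') + 1)
    (hρ : ρ = βo / (2 * lo')) (hMo : Mo = 8 * a ^ 2 * (1 + m₂))
    (hη₀ : η₀ = 2 * a ^ 2 * 3 / (((R : ℝ) - M) * (4 * Real.pi ^ 2 * lo')))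
    {ε : ℝ} (hε : 0 < ε)
    (hU₁ : U₁ = (1 + m₂) / (4 * a ^ 2) * (2 + 2 * a ^ 2 / ε)) (hU₂ : U₂ = (1 + m₂) / (4 * a ^ 2) * (2 * ε))
    (hU₃ : U₃ = (1 + m₂) / (4 * a ^ 2) * (2 * a ^ 2 * 3 / (((R : ℝ) - M) * (4 * Real.pi ^ 2 * lo')) + 4 * a ^ 2 / (4 * Real.pi ^ 2 * lo' * ((R : ℝ) - M) ^ 2)))
    (hb : b = (lo₁ / (4 * S ^ 2)) ^ (1 / 3 : ℝ)) (hq : q = 1 / Real.sqrt (2 * S))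
    (hlam : lam = min (lo₁ / (6 * (S * b ^ 2))) (min (lo₁ / (6 * U₂)) (min (1 / (6 * U₃)) (b / (3 * U₁)))))
    -- the two environmental conditions
    (hF : 128 * (ρ * (1 + Mo)) ^ 2 ≤ S) (Q4 : 16 * b * η₀ ≤ 1) :
    0 < lam ∧ ‖u (W₁.start i + 3 * (W₁.phase i).τ / 4)‖ ^ 2 ≤
      3 * (1 + S * b ^ 2 / (2 * δ₁ * lo₁)) * Real.exp (-(lam * ((W₁.phase i).τ / 2 - δ₁))) * ‖u (W₁.start i + (W₁.phase i).τ / 4)‖ ^ 2 := by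
  have hδt : W₁.start i + (W₁.phase i).τ / 4 + δ₁ ≤ W₁.start i + 3 * (W₁.phase i).τ / 4 := by linarith
  have hG : ∀ t ∈ Icc (W₁.start i + (W₁.phase i).τ / 4) (W₁.start i + 3 * (W₁.phase i).τ / 4),
      (1 / 2 : ℝ) ≤ slotEnvelope W₁ i t ∧ slotEnvelope W₁ i t ≤ 1 := fun t ht => slotEnvelope_halfWindow W₁ i ht
  have hoff : ∀ t ∈ Icc (W₁.start i + (W₁.phase i).τ / 4) (W₁.start i + 3 * (W₁.phase i).τ / 4), ∀ j, j ≠ i → slotEnvelope W₁ j t = 0 :=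
    fun t ht j hj => slotEnvelope_other_halfWindow W₁ i ht j hj
  have hη₀' : η₀ = 1 * (2 * a ^ 2 * 3 / (((R : ℝ) - M) * (4 * Real.pi ^ 2 * lo'))) := by rw [one_mul]; exact hη₀
  have hb' : b = (1 / 2 * lo₁ / (2 * S ^ 2 * (1:ℝ) ^ 2)) ^ (1 / 3 : ℝ) := by
    rw [hb]; congr 1; ring
  have hlam' : lam = min (lo₁ / (6 * (S * b ^ 2))) (min (lo₁ / (6 * U₂)) (min (1 / (6 * U₃)) (2 * b * (1 / 2) / (3 * U₁)))) := by
    rw [hlam]; congr 3; ring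
  have h := ladder_crush_choice W₁ i z₀ hhop hM hMR h𝔸 hlo' hhi hoddA hβo hγ₁ hδ hδt hu h0 hoff hG one_half_pos ha0 ha hm₂ hlo₁ hS hρ hMo hη₀'
    hε hU₁ hU₂ hU₃ hb' hq hlam' hF Q4
  have e : W₁.start i + 3 * (W₁.phase i).τ / 4 - (W₁.start i + (W₁.phase i).τ / 4) - δ₁ = (W₁.phase i).τ / 2 - δ₁ := by ring
  rw [e] at h
  exact h

end Summit.AnomalousDissipation.AnomalousDissipation.Theorems.SolenoidalFractalHomogenisation.LagrangianStep.Sideband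

end
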